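import Literature.MathematicalPhysics.QuantumLattice.DWaveKomaTasakiSystem
import Literature.MathematicalPhysics.QuantumLattice.KomaTasakiGriffithsTheoremProofs
import Literature.MathematicalPhysics.QuantumLattice.KomaTasakiGriffithsTheoremSU2Proofs
import Literature.MathematicalPhysics.QuantumLattice.InfVolFermionStateGaugeCommutator
import HarnessLib

/-!
# The pair-sourced grand-canonical Hubbard torus IS a Koma–Tasaki `ℤ₂` system (KT93 §2), so at EVERY
# temperature thermal pair long-range order forces the sourced thermal pair amplitude (KT93 Thm 2.1 BY NAME)

Topic `Literature/MathematicalPhysics/QuantumLattice` (namespace = path). Seat `hubbard-cq-p4` (cell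
`pub/hubbard-cq`, row "finite-h KLS/Koma–Tasaki dictionary"): the `T > 0` column of the dictionary
(KLS-KT-DICTIONARY §D row «KT93 Thm 2.1 / Cor 2.2»), which became available when hubbard-cq-lit-1
DISCHARGED `KomaTasaki.kt93_theorem_2_1` (`KomaTasakiGriffithsTheoremProofs.lean`): Koma–Tasaki /
Griffiths at positive temperature for order operators NOT commuting with the Hamiltonian.
Everything is PROVED (one definition: the instance).

T. Koma, H. Tasaki, *Symmetry breaking in Heisenberg antiferromagnets*, Commun. Math. Phys. **158** (1993)
191–214, §2 and §7 (p. 211: Theorem 7.3 / the method "allows one to apply the theorem to … the electron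
pair condensation problems in lattice electron systems"); J. Stat. Phys. **76** (1994) §3.3–3.4 (the
Hubbard-model data `h_x`, `o_x = P_x + P_x†`, `U(1)` generated by `N/2`).

## What is constructed and proved

For the torus `(ℤ/Lℤ)²`, hopping `t`, coupling `U`, chemical potential `μ` and a pair form factor `g` on
`{0, ±e₁, ±e₂}` (`d`-wave: `dWaveFormFactor`):

* `gaugeAut_hubbardTorusWith` (`γ_θ` fixes `H(t,U) − μN`), `hasGaugeCharge_pairField`
  (`Δ_g` has gauge charge `−2`), `gaugeAut_pi_div_two_pairField_add` (the gauge QUARTER TURN flips the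
  sign of `Δ_g + Δ_g†`) — from the tree's commutator identities `[H, N] = 0`, `Δ N = NΔ + 2Δ`
  (`DWaveKomaTasakiSystem.lean`) through the commutator form of charge (`hasGaugeCharge_iff_commutator`).
* **`dWaveZ2System L t U μ g : KomaTasaki.Z2System (card Λ_L) (45(2|t|+|U|+2|μ|)) (2K_g) 25 (Fock)`** —
  KT93 §2 data: sites enumerated by `Fintype.equivFin`, `h_x = DWaveKT.localHam` (Hubbard terms anchored
  at `x`), `o_x = P_x + P_x† = DWaveKT.pairDensity 0`, the symmetry unitary `U_Λ = e^{i(π/2)N̂}`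
  (`fockGaugeU1 (π/2)`: (2.3) `U H U* = H`, (2.5) `U O U* = −O`), supports `S(x) =` the 25 sites whose
  plaquettes meet that of `x` (ii), iii) by graded locality and the tree's norm counts).
* dictionary: `dWaveZ2System_hamiltonian` (`H_Λ = hubbardTorusWith 2 L t U μ`), `dWaveZ2System_order`
  (`O_Λ = Δ_g + Δ_g†`), `dWaveZ2System_fieldHamiltonian` (`H_Λ(B) = H − μN − B(Δ_g + Δ_g†)`;
  `= dWaveSourceTorus L U μ B` at `t = 1`, `g = d`: `dWaveZ2System_fieldHamiltonian_dWave`),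
  `dWaveZ2System_magnetisation_dWave`
  (`m_Λ(B) = L⁻² Re ⟨Δ_d + Δ_d†⟩_{β, dWaveSourceTorus L U μ B}`), `dWaveZ2System_moment_dWave`
  (`N^{-2k}⟨O^{2k}⟩_Λ(0) = L^{-4k} Re ⟨(Δ_d+Δ_d†)^{2k}⟩_{β, dWaveSourceTorus L U μ 0}`).
* **`dWave_kt93_theorem_2_1`** — KT93 Theorem 2.1 for the pair-sourced Hubbard tori BY NAME: for every
  `β > 0`, `t, U, μ, g`, under KT's hypothesis i) (the sourced free energies per site converge for every
  field `B`), for every `k ≥ 1`, `B > 0`, `ε > 0`, eventually in `L, L'`: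
  `(N_{L'}^{-2k} ⟨O^{2k}⟩_{L'}(0))^{1/(2k)} ≤ N_L⁻¹ ⟨O⟩_L(B) + ε` (volume first, then `B ↓ 0`: thermal
  pair LRO of the symmetric Gibbs states forces the sourced thermal pair amplitude);
  **`dWave_thermal_pairLRO_le_sourcedPairAmplitude`** — the `k = 1`, `t = 1`, `d`-wave reading in torus
  vocabulary: `√(L'^{-4} Re⟨(Δ_d+Δ_d†)²⟩_{β,h=0,L'}) ≤ L^{-2} Re⟨Δ_d+Δ_d†⟩_{β,B,L} + ε` eventually.

## Honest placement
Direction LRO ⇒ RESPONSE at `T > 0` (the thermal twin of the tree's `T = 0` chain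
`le_dWaveOrderParameter_of_pairLRO`); hypothesis i) (existence of the sourced free-energy density for
every `B`) is KT's own and is NOT discharged here (no sub-additivity theorem for the pair-sourced fermion
torus is in the tree); the constant is `1`, not the `√2` of the `U(1)` remark after KT93 Thm 6.1 (only the
`SU(2)` `√3` is printed as a theorem and proved in the tree, `kt93_corollary_2_2_holds`). Not an
instrument: a finite-`(B, L)` inequality is NOT asserted (none is printed for `β < ∞`).

## References
* T. Koma, H. Tasaki, Commun. Math. Phys. 158 (1993) 191–214, §2 (2.1)–(2.13), Thm 2.1; §7 p. 211.
  [cite: KomaTasaki1993, §2 Theorem 2.1]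
* T. Koma, H. Tasaki, J. Stat. Phys. 76 (1994) 745–803, §3.3–3.4. [cite: KomaTasaki1994, §3.3–3.4]
* O. Bratteli, D. W. Robinson, *OAQSM 2* (1997), §5.2.2 (gauge group). [cite: BratteliRobinsonII1997, §5.2.2]
-/

noncomputable section

open Matrix Complex Finset Filter Literature.Probability.LatticeModels
open scoped Matrix.Norms.L2Operator ComplexOrder Topology

namespace Literature.MathematicalPhysics.QuantumLattice

open DWaveKT

/-- ONE `DecidableEq (FermionTorus 2 L)` instance for the whole file (as in `DWaveKomaTasakiSystem.lean`):
the generic CAR / gauge lemmas carry `LinearOrder.toDecidableEq`, instance resolution on the concrete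
torus would otherwise find the computable instance, and two names for the same instance make the kernel
time out on `1 : Matrix _ _ ℂ` (field `U_mul_conjTranspose`). [folklore] -/
local instance (priority := high) instDecidableEqFermionTorusKTThermal {L : ℕ} :
    DecidableEq (FermionTorus 2 L) :=
  LinearOrder.toDecidableEq

/-! ### Gauge charges of the torus operators -/

section Gauge

variable (L : ℕ) [NeZero L] (t U μ : ℝ) (g : Site 2 → ℝ)

omit [NeZero L] in
/-- **The grand-canonical Hubbard Hamiltonian of the torus is gauge invariant**: `γ_θ(H(t,U) − μN) = H(t,U) − μN`
(`[H − μN, N] = 0`). [cite: BratteliRobinsonII1997, §5.2.2] -/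
theorem gaugeAut_hubbardTorusWith (θ : ℝ) :
    gaugeAut θ (hubbardTorusWith 2 L t U μ) = hubbardTorusWith 2 L t U μ := by
  refine forall_gaugeAut_eq_iff_commute.2 ?_ θ
  rw [totalNumberOp_eq_totalNumber]
  exact (hamiltonianWith_commute_totalNumber (fermionTorusGraph 2 L) t U μ).symm

/-- **The bond pair field `Δ_g` has gauge charge `−2`** (`N Δ − Δ N = −2Δ`).
[cite: KomaTasaki1994, §3.3 (2.16)] -/
theorem hasGaugeCharge_pairField : HasGaugeCharge (-2) (pairField g L) := by
  refine hasGaugeCharge_iff_commutator.2 ?_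
  rw [totalNumberOp_eq_totalNumber, pairField_mul_totalNumber]
  push_cast
  module

/-- `Δ_g†` has gauge charge `+2`. [cite: KomaTasaki1994, §3.3 (2.16)] -/
theorem hasGaugeCharge_pairField_conjTranspose : HasGaugeCharge 2 (pairField g L)ᴴ := by
  simpa using (hasGaugeCharge_pairField L g).conjTranspose

/-- **The gauge quarter turn flips the order operator**: `γ_{π/2}(Δ_g + Δ_g†) = −(Δ_g + Δ_g†)`
(`e^{∓iπ} = −1`) — KT93's sign-flipping unitary (2.5) for the pair field. [cite: KomaTasaki1993, §2 (2.5)] -/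
theorem gaugeAut_pi_div_two_pairField_add :
    gaugeAut (Real.pi / 2) (pairField g L + (pairField g L)ᴴ) = -(pairField g L + (pairField g L)ᴴ) := by
  rw [gaugeAut_apply, Matrix.mul_add, Matrix.add_mul, ← gaugeAut_apply, ← gaugeAut_apply,
    hasGaugeCharge_pairField L g (Real.pi / 2), hasGaugeCharge_pairField_conjTranspose L g (Real.pi / 2)]
  have h1 : exp (I * ((Real.pi / 2 : ℝ) : ℂ) * ((-2 : ℤ) : ℂ)) = -1 := by
    rw [show I * ((Real.pi / 2 : ℝ) : ℂ) * ((-2 : ℤ) : ℂ) = -(Real.pi * I) by push_cast; ring, Complex.exp_neg,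
      Complex.exp_pi_mul_I]
    norm_num
  have h2 : exp (I * ((Real.pi / 2 : ℝ) : ℂ) * ((2 : ℤ) : ℂ)) = -1 := by
    rw [show I * ((Real.pi / 2 : ℝ) : ℂ) * ((2 : ℤ) : ℂ) = Real.pi * I by push_cast; ring, Complex.exp_pi_mul_I]
  rw [h1, h2, neg_one_smul, neg_one_smul, neg_add]

end Gauge

/-! ### The `ℤ₂` system of KT93 §2 for the pair field of the Hubbard torus -/

section Instance

variable (L : ℕ) [NeZero L] (t U μ : ℝ) (g : Site 2 → ℝ)

/-- Outside the overlap set the plaquettes are disjoint. [cite: KomaTasaki1994, §2.3 ii)] -/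
private theorem disjoint_plaq_of_not_mem' {y y' : TorusSite 2 L} (h : y' ∉ overlapSet L y) :
    Disjoint (plaq L y) (plaq L y') := by
  simpa [overlapSet] using h

/-- **THE PAIR-SOURCED HUBBARD TORUS AS A KOMA–TASAKI `ℤ₂` SYSTEM** (KT93 §2 data (2.1)–(2.5), ii), iii)):
`N = |Λ_L|` sites (enumerated by `Fintype.equivFin`), `h_x =` the Hubbard terms anchored at `x`
(`DWaveKT.localHam`, `Σ_x h_x = H(t,U) − μN`), `o_x = P_x + P_x†` (`DWaveKT.pairDensity 0`,
`Σ_x o_x = Δ_g + Δ_g†`), the symmetry unitary `U_Λ = e^{i(π/2)N̂}` ((2.3) `U H U* = H` by particle-number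
conservation, (2.5) `U O U* = −O` since `Δ_g` has charge `−2`), supports `S(x) =` the `≤ 25` sites whose
5-site plaquettes meet that of `x` (graded locality of even operators), `h̄ = 45(2|t|+|U|+2|μ|)`,
`ō = 2K_g`, `r = 25`. [cite: KomaTasaki1993, §2 (2.1)–(2.9), ii), iii)] [cite: KomaTasaki1994, §3.3–3.4] -/
def dWaveZ2System :
    KomaTasaki.Z2System (Fintype.card (TorusSite 2 L)) (45 * (2 * |t| + |U| + 2 * |μ|))
      (2 * pairNormConst g) 25 (FockIdx L) where
  h i := localHam L t U μ ((Fintype.equivFin (TorusSite 2 L)).symm i)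
  o i := pairDensity L g 0 ((Fintype.equivFin (TorusSite 2 L)).symm i)
  U := fockGaugeU1 (Real.pi / 2)
  supp i := (overlapSet L ((Fintype.equivFin (TorusSite 2 L)).symm i)).map
    (Fintype.equivFin (TorusSite 2 L)).toEmbedding
  isHermitian_h i := isHermitian_localHam L t U μ _
  isHermitian_o i := isHermitian_pairDensity L g 0 _
  U_mul_conjTranspose := fockGaugeU1_mul_conjTranspose_self _
  conj_hamiltonian := by
    rw [(Fintype.equivFin (TorusSite 2 L)).symm.sum_comp (fun y => localHam L t U μ y), sum_localHam,
      ← gaugeAut_apply, gaugeAut_hubbardTorusWith]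
  conj_order := by
    rw [(Fintype.equivFin (TorusSite 2 L)).symm.sum_comp (fun y => pairDensity L g 0 y), sum_pairDensity_zero,
      ← gaugeAut_apply, gaugeAut_pi_div_two_pairField_add]
  norm_h_le i := norm_localHam_le L t U μ _
  norm_o_le i := norm_pairDensity_le L g 0 _
  commute_h_o i j hj := by
    have hj' : (Fintype.equivFin (TorusSite 2 L)).symm j ∉
        overlapSet L ((Fintype.equivFin (TorusSite 2 L)).symm i) := by
      rwa [Finset.mem_map_equiv] at hj
    exact commute_of_mem_carEvenSubalgebra (localHam_mem L t U μ _)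
      ((carEvenSubalgebra_le_carSubalgebra _) (pairDensity_mem L g 0 _))
      (disjoint_orbSet (disjoint_plaq_of_not_mem' L hj'))
  card_supp_le i := by
    rw [Finset.card_map]
    exact card_overlapSet_le L _
  two_le_r := by norm_num

/-- `H_Λ = H(t,U) − μN` (`hubbardTorusWith 2 L t U μ`). [cite: KomaTasaki1993, §2 (2.2)] -/
theorem dWaveZ2System_hamiltonian : (dWaveZ2System L t U μ g).hamiltonian = hubbardTorusWith 2 L t U μ := by
  rw [KomaTasaki.Z2System.hamiltonian]
  change ∑ i, localHam L t U μ ((Fintype.equivFin (TorusSite 2 L)).symm i) = _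
  rw [(Fintype.equivFin (TorusSite 2 L)).symm.sum_comp (fun y => localHam L t U μ y), sum_localHam]

/-- `O_Λ = Δ_g + Δ_g†`. [cite: KomaTasaki1993, §2 (2.4)] -/
theorem dWaveZ2System_order : (dWaveZ2System L t U μ g).order = pairField g L + (pairField g L)ᴴ := by
  rw [KomaTasaki.Z2System.order]
  change ∑ i, pairDensity L g 0 ((Fintype.equivFin (TorusSite 2 L)).symm i) = _
  rw [(Fintype.equivFin (TorusSite 2 L)).symm.sum_comp (fun y => pairDensity L g 0 y), sum_pairDensity_zero]

/-- `H_Λ(B) = H(t,U) − μN − B(Δ_g + Δ_g†)`. [cite: KomaTasaki1993, §2 (2.6)] -/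
theorem dWaveZ2System_fieldHamiltonian (B : ℝ) :
    (dWaveZ2System L t U μ g).fieldHamiltonian B =
      hubbardTorusWith 2 L t U μ - (B : ℂ) • (pairField g L + (pairField g L)ᴴ) := by
  rw [KomaTasaki.Z2System.fieldHamiltonian, dWaveZ2System_hamiltonian, dWaveZ2System_order]

/-- At `t = 1`, `g = dWaveFormFactor`: `H_Λ(B) = dWaveSourceTorus L U μ B`. [cite: KomaTasaki1994, §1] -/
theorem dWaveZ2System_fieldHamiltonian_dWave (B : ℝ) :
    (dWaveZ2System L 1 U μ dWaveFormFactor).fieldHamiltonian B = dWaveSourceTorus L U μ B := by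
  rw [dWaveZ2System_fieldHamiltonian, dWaveSourceTorus_eq_sub]

/-- `H_Λ(0) = dWaveSourceTorus L U μ 0` for the `d`-wave system at `t = 1`. [cite: KomaTasaki1994, §1] -/
theorem dWaveZ2System_hamiltonian_dWave :
    (dWaveZ2System L 1 U μ dWaveFormFactor).hamiltonian = dWaveSourceTorus L U μ 0 := by
  rw [← KomaTasaki.Z2System.fieldHamiltonian_zero, dWaveZ2System_fieldHamiltonian_dWave]

/-- `|Λ_L| = L²` for the torus `(ℤ/Lℤ)²`. [folklore] -/
private theorem card_torusSite_sq : Fintype.card (TorusSite 2 L) = L ^ 2 := by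
  simp [TorusSite, ZMod.card]

/-- **The field-induced order parameter of the instance is the sourced thermal pair amplitude**:
`m_Λ(B) = L⁻² · Re ⟨Δ_d + Δ_d†⟩_{β, dWaveSourceTorus L U μ B}` (Gibbs state of the sourced torus).
[cite: KomaTasaki1993, §2 (2.9), (2.11)] -/
theorem dWaveZ2System_magnetisation_dWave (β B : ℝ) :
    (dWaveZ2System L 1 U μ dWaveFormFactor).magnetisation β B =
      ((L : ℝ) ^ 2)⁻¹ * (gibbsState β (dWaveSourceTorus L U μ B)
        (pairField dWaveFormFactor L + (pairField dWaveFormFactor L)ᴴ)).re := by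
  rw [KomaTasaki.Z2System.magnetisation, dWaveZ2System_fieldHamiltonian_dWave, dWaveZ2System_order,
    card_torusSite_sq, Nat.cast_pow]

/-- **The zero-field moments of the instance are the thermal pair-LRO moments**:
`N^{-2k} ⟨O^{2k}⟩_Λ(0) = (L²)^{-2k} · Re ⟨(Δ_d + Δ_d†)^{2k}⟩_{β, dWaveSourceTorus L U μ 0}`.
[cite: KomaTasaki1993, §2 (2.12)–(2.13)] -/
theorem dWaveZ2System_moment_dWave (β : ℝ) (k : ℕ) :
    (dWaveZ2System L 1 U μ dWaveFormFactor).moment β k =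
      (((L : ℝ) ^ 2) ^ (2 * k))⁻¹ * (gibbsState β (dWaveSourceTorus L U μ 0)
        ((pairField dWaveFormFactor L + (pairField dWaveFormFactor L)ᴴ) ^ (2 * k))).re := by
  rw [KomaTasaki.Z2System.moment, dWaveZ2System_hamiltonian_dWave, dWaveZ2System_order, card_torusSite_sq,
    Nat.cast_pow]

end Instance

/-! ### KT93 Theorem 2.1 for the pair-sourced Hubbard tori, by name -/

section Thermal

/-- `|Λ_{L+1}| = (L+1)² → ∞`. [cite: KomaTasaki1993, §2 (van Hove sequences have |Λ| → ∞)] -/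
theorem tendsto_card_torusSite_succ :
    Tendsto (fun L : ℕ => Fintype.card (TorusSite 2 (L + 1))) atTop atTop := by
  have h : (fun L : ℕ => Fintype.card (TorusSite 2 (L + 1))) = fun L => (L + 1) ^ 2 :=
    funext fun L => card_torusSite_sq (L + 1)
  rw [h]
  exact (tendsto_pow_atTop two_ne_zero).comp (tendsto_add_atTop_nat 1)

/-- **KOMA–TASAKI 1993 THEOREM 2.1 FOR THE PAIR-SOURCED HUBBARD TORI** (`T > 0`, every `β > 0`):
for the sequence of systems `dWaveZ2System (L+1) t U μ g` (tori `(ℤ/(L+1)ℤ)²`), under KT's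
hypothesis i) — for every field `B` the free energies per site
`f_L(B) = −(β|Λ_L|)⁻¹ log Tr e^{−β(H − μN − B(Δ_g+Δ_g†))}` converge as `L → ∞` — one has, for every
`k ≥ 1`, `B > 0`, `ε > 0`, eventually in `L, L'`:
`(|Λ_{L'}|^{-2k} ⟨(Δ_g+Δ_g†)^{2k}⟩_{β,0,L'})^{1/(2k)} ≤ |Λ_L|⁻¹ ⟨Δ_g+Δ_g†⟩_{β,B,L} + ε`
— thermal pair long-range order of the symmetric Gibbs states forces a sourced thermal pair amplitude
(volume limit first, then `B ↓ 0`). Instance of the tree's `kt93_theorem_2_1_holds`.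
[cite: KomaTasaki1993, §2 Theorem 2.1 (2.13)] -/
theorem dWave_kt93_theorem_2_1 (t U μ : ℝ) (g : Site 2 → ℝ) {β : ℝ} (hβ : 0 < β)
    (hlim : ∀ B : ℝ, ∃ f : ℝ,
      Tendsto (fun L : ℕ => (dWaveZ2System (L + 1) t U μ g).freeEnergy β B) atTop (𝓝 f))
    {k : ℕ} (hk : 1 ≤ k) {B : ℝ} (hB : 0 < B) {ε : ℝ} (hε : 0 < ε) :
    ∃ L₀ : ℕ, ∀ L L' : ℕ, L₀ ≤ L → L₀ ≤ L' →
      ((dWaveZ2System (L' + 1) t U μ g).moment β k) ^ ((1 : ℝ) / (2 * k)) ≤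
        (dWaveZ2System (L + 1) t U μ g).magnetisation β B + ε :=
  KomaTasaki.kt93_theorem_2_1_holds _ _ _ (fun L => Fintype.card (TorusSite 2 (L + 1)))
    (fun L => FockIdx (L + 1)) (fun L => dWaveZ2System (L + 1) t U μ g) β hβ tendsto_card_torusSite_succ
    hlim k hk B hB ε hε

/-- **THERMAL `d`-WAVE PAIR LRO FORCES THE SOURCED THERMAL PAIR AMPLITUDE** (`k = 1`, `t = 1`, `d`-wave,
torus vocabulary): under hypothesis i) for the Gibbs free energies of `dWaveSourceTorus (L+1) U μ B`,
for every `B > 0`, `ε > 0`, eventually in `L, L'`: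
`√( ((L'+1)²)⁻² · Re⟨(Δ_d+Δ_d†)²⟩_{β, dWaveSourceTorus (L'+1) U μ 0} )
   ≤ ((L+1)²)⁻¹ · Re⟨Δ_d+Δ_d†⟩_{β, dWaveSourceTorus (L+1) U μ B} + ε`.
The `T > 0` twin of the tree's `T = 0` chain `le_dWaveOrderParameter_of_pairLRO` (direction
LRO ⇒ response only; constant `1`). [cite: KomaTasaki1993, §2 Theorem 2.1 (2.13), k = 1] -/
theorem dWave_thermal_pairLRO_le_sourcedPairAmplitude (U μ : ℝ) {β : ℝ} (hβ : 0 < β)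
    (hlim : ∀ B : ℝ, ∃ f : ℝ,
      Tendsto (fun L : ℕ => (dWaveZ2System (L + 1) 1 U μ dWaveFormFactor).freeEnergy β B) atTop (𝓝 f))
    {B : ℝ} (hB : 0 < B) {ε : ℝ} (hε : 0 < ε) :
    ∃ L₀ : ℕ, ∀ L L' : ℕ, L₀ ≤ L → L₀ ≤ L' →
      Real.sqrt (((((L' + 1 : ℕ) : ℝ) ^ 2) ^ 2)⁻¹ *
          (gibbsState β (dWaveSourceTorus (L' + 1) U μ 0)
            ((pairField dWaveFormFactor (L' + 1) + (pairField dWaveFormFactor (L' + 1))ᴴ) ^ 2)).re) ≤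
        ((((L + 1 : ℕ) : ℝ) ^ 2))⁻¹ * (gibbsState β (dWaveSourceTorus (L + 1) U μ B)
          (pairField dWaveFormFactor (L + 1) + (pairField dWaveFormFactor (L + 1))ᴴ)).re + ε := by
  obtain ⟨L₀, hL₀⟩ := dWave_kt93_theorem_2_1 1 U μ dWaveFormFactor hβ hlim (le_refl 1) hB hε
  refine ⟨L₀, fun L L' hL hL' => ?_⟩
  have h := hL₀ L L' hL hL'
  rw [dWaveZ2System_moment_dWave, dWaveZ2System_magnetisation_dWave] at h
  rw [Real.sqrt_eq_rpow]
  convert h using 2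
  norm_num

/-- **The free energy per site of the `d`-wave system is the sourced torus pressure** (up to sign):
`f_{L}(B) = −log Re Z_β(dWaveSourceTorus L U μ B) / (β L²)`. [cite: KomaTasaki1993, §2 (2.8)] -/
theorem dWaveZ2System_freeEnergy_dWave (L : ℕ) [NeZero L] (U μ β B : ℝ) :
    (dWaveZ2System L 1 U μ dWaveFormFactor).freeEnergy β B =
      -(Real.log (partitionFn β (dWaveSourceTorus L U μ B)).re / (β * (L : ℝ) ^ 2)) := by
  rw [KomaTasaki.Z2System.freeEnergy, dWaveZ2System_fieldHamiltonian_dWave, card_torusSite_sq, Nat.cast_pow,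
    div_eq_inv_mul, neg_mul]

/-- **Hypothesis i) from a sourced-pressure limit in `ε–L₀` form.** If for every source `h` the sourced
torus pressure `log Re Z_β(dWaveSourceTorus L U μ h)/(βL²)` converges as `L → ∞` (stated as
`∃ q, ∀ κ > 0, ∃ L₀, ∀ L ≥ L₀, |… − q| ≤ κ` — exactly the form of the Hubbard summit's support theorem
`Theorems.stub_sourcedPressureLimit` of route ThermalWedge, which DISCHARGES it for all `β > 0, U, μ, h`), then
KT's hypothesis i) holds for the systems `dWaveZ2System (L+1) 1 U μ d`. [cite: KomaTasaki1993, §2 i) (2.10)] -/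
theorem dWaveZ2System_freeEnergy_tendsto_of_pressureLimit (U μ β : ℝ)
    (hq : ∀ h : ℝ, ∃ q : ℝ, ∀ κ : ℝ, 0 < κ → ∃ L₀ : ℕ, ∀ (L : ℕ) [NeZero L], L₀ ≤ L →
      |Real.log (partitionFn β (dWaveSourceTorus L U μ h)).re / (β * (L : ℝ) ^ 2) - q| ≤ κ) (B : ℝ) :
    ∃ f : ℝ, Tendsto (fun L : ℕ => (dWaveZ2System (L + 1) 1 U μ dWaveFormFactor).freeEnergy β B) atTop (𝓝 f) := by
  obtain ⟨q, hqB⟩ := hq B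
  refine ⟨-q, Metric.tendsto_atTop.2 fun κ hκ => ?_⟩
  obtain ⟨L₀, hL₀⟩ := hqB (κ / 2) (half_pos hκ)
  refine ⟨L₀, fun L hL => ?_⟩
  have h := hL₀ (L + 1) (by omega)
  rw [dWaveZ2System_freeEnergy_dWave, Real.dist_eq, Nat.cast_succ]
  rw [Nat.cast_succ] at h
  rw [show -(Real.log (partitionFn β (dWaveSourceTorus (L + 1) U μ B)).re / (β * ((L : ℝ) + 1) ^ 2)) - -q =
      -(Real.log (partitionFn β (dWaveSourceTorus (L + 1) U μ B)).re / (β * ((L : ℝ) + 1) ^ 2) - q) by ring,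
    abs_neg]
  linarith

/-- **THERMAL `d`-WAVE PAIR LRO FORCES THE SOURCED THERMAL PAIR AMPLITUDE — from a sourced-pressure limit.**
As `dWave_thermal_pairLRO_le_sourcedPairAmplitude`, with hypothesis i) replaced by the `ε–L₀` pressure-limit
statement `∀ h, ∃ q, ∀ κ > 0, ∃ L₀, ∀ L ≥ L₀, |log Re Z_β(dWaveSourceTorus L U μ h)/(βL²) − q| ≤ κ` (the
Hubbard summit's `Theorems.stub_sourcedPressureLimit β U μ h hβ` supplies it verbatim, making the conclusion
UNCONDITIONAL for every `β > 0`, `U`, `μ` on the summit side). [cite: KomaTasaki1993, §2 Theorem 2.1 (2.13)] -/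
theorem dWave_thermal_pairLRO_le_sourcedPairAmplitude_of_pressureLimit (U μ : ℝ) {β : ℝ} (hβ : 0 < β)
    (hq : ∀ h : ℝ, ∃ q : ℝ, ∀ κ : ℝ, 0 < κ → ∃ L₀ : ℕ, ∀ (L : ℕ) [NeZero L], L₀ ≤ L →
      |Real.log (partitionFn β (dWaveSourceTorus L U μ h)).re / (β * (L : ℝ) ^ 2) - q| ≤ κ)
    {B : ℝ} (hB : 0 < B) {ε : ℝ} (hε : 0 < ε) :
    ∃ L₀ : ℕ, ∀ L L' : ℕ, L₀ ≤ L → L₀ ≤ L' →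
      Real.sqrt (((((L' + 1 : ℕ) : ℝ) ^ 2) ^ 2)⁻¹ *
          (gibbsState β (dWaveSourceTorus (L' + 1) U μ 0)
            ((pairField dWaveFormFactor (L' + 1) + (pairField dWaveFormFactor (L' + 1))ᴴ) ^ 2)).re) ≤
        ((((L + 1 : ℕ) : ℝ) ^ 2))⁻¹ * (gibbsState β (dWaveSourceTorus (L + 1) U μ B)
          (pairField dWaveFormFactor (L + 1) + (pairField dWaveFormFactor (L + 1))ᴴ)).re + ε :=
  dWave_thermal_pairLRO_le_sourcedPairAmplitude U μ hβ
    (dWaveZ2System_freeEnergy_tendsto_of_pressureLimit U μ β hq) hB hε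

end Thermal


/-! ### The `U(1)` factor `√2` (KT93 Remark after Theorem 6.1, lit-1's `Z2System.kt93_corollary_2_2_u1`) -/

section SqrtTwo

variable (L : ℕ) [NeZero L] (t U μ : ℝ) (g : Site 2 → ℝ)

/-- The second order component `O^{(2)} = i(Δ_g − Δ_g†)` is Hermitian. [cite: KomaTasaki1994, §3.3 (2.13)] -/
theorem isHermitian_I_smul_pairField_sub : (I • (pairField g L - (pairField g L)ᴴ)).IsHermitian := by
  rw [← sum_pairDensity_one]
  exact isHermitian_finset_sum _ fun y _ => isHermitian_pairDensity L g 1 y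

/-- `‖i(Δ_g − Δ_g†)‖ ≤ 2K_g · |Λ|`. [cite: KomaTasaki1993, §2 ii)] -/
theorem norm_I_smul_pairField_sub_le :
    ‖I • (pairField g L - (pairField g L)ᴴ)‖ ≤ 2 * pairNormConst g * Fintype.card (TorusSite 2 L) := by
  rw [← sum_pairDensity_one]
  calc ‖∑ y, pairDensity L g 1 y‖ ≤ ∑ y, ‖pairDensity L g 1 y‖ := norm_sum_le _ _
    _ ≤ ∑ _y : TorusSite 2 L, 2 * pairNormConst g := Finset.sum_le_sum fun y _ => norm_pairDensity_le L g 1 y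
    _ = 2 * pairNormConst g * Fintype.card (TorusSite 2 L) := by
        rw [Finset.sum_const, Finset.card_univ, nsmul_eq_mul]; ring

/-- v) for pairing: `[N̂, i(Δ_g − Δ_g†)] = −2i·(Δ_g + Δ_g†)`. [cite: KomaTasaki1994, (2.14), §3.3] -/
theorem totalNumber_comm_I_smul_pairField_sub :
    totalNumber * (I • (pairField g L - (pairField g L)ᴴ)) - (I • (pairField g L - (pairField g L)ᴴ)) * totalNumber =
      (-2 * I) • (pairField g L + (pairField g L)ᴴ) := by
  rw [Matrix.mul_smul, Matrix.smul_mul, Matrix.mul_sub, Matrix.sub_mul, pairField_mul_totalNumber,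
    pairField_conjTranspose_mul_totalNumber]
  module

/-- v) for pairing: `[N̂, Δ_g + Δ_g†] = −(−2i · i(Δ_g − Δ_g†))`. [cite: KomaTasaki1994, (2.14), §3.3] -/
theorem totalNumber_comm_pairField_add :
    totalNumber * (pairField g L + (pairField g L)ᴴ) - (pairField g L + (pairField g L)ᴴ) * totalNumber =
      -((-2 * I) • (I • (pairField g L - (pairField g L)ᴴ))) := by
  rw [smul_smul, Matrix.mul_add, Matrix.add_mul, pairField_mul_totalNumber, pairField_conjTranspose_mul_totalNumber,
    show -2 * I * I = 2 by rw [mul_assoc, Complex.I_mul_I]; ring]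
  module

/-- **The commutator bound under bounded overlap for the pair field**: `‖[i(Δ−Δ†), Δ+Δ†]‖ ≤ 50·(2K_g)²·|Λ|`
(`κ = 2r′ = 50` for the 25-plaquette overlap; the matrix form of `U1OverlapSystem.norm_orderComm_le` for the
instance `dWaveKTSystem`). [cite: KomaTasaki1993, (7.22)] [cite: KomaTasaki1994, §4] -/
theorem norm_comm_orderTwo_orderOne_le (hg : 0 < pairNormConst g) :
    ‖(I • (pairField g L - (pairField g L)ᴴ)) * (pairField g L + (pairField g L)ᴴ) -
        (pairField g L + (pairField g L)ᴴ) * (I • (pairField g L - (pairField g L)ᴴ))‖ ≤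
      50 * (2 * pairNormConst g) ^ 2 * Fintype.card (TorusSite 2 L) := by
  have h := (dWaveKTSystem L 0 0 0 g hg).norm_orderComm_le
  rw [dWaveKTSystem_order_zero, dWaveKTSystem_order_one, dWaveKTSystem_obar, dWaveKTSystem_r', ← map_mul,
    ← map_mul, ← map_sub, Matrix.l2_opNorm_toEuclideanCLM, ← norm_neg, neg_sub] at h
  calc _ ≤ 2 * (2 * pairNormConst g) ^ 2 * ((25 : ℕ) : ℝ) * Fintype.card (TorusSite 2 L) := h
    _ = 50 * (2 * pairNormConst g) ^ 2 * Fintype.card (TorusSite 2 L) := by push_cast; ring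

/-- **KOMA–TASAKI 1993, COROLLARY 2.2 WITH THE `U(1)` FACTOR `√2`, FOR THE PAIR-SOURCED HUBBARD TORI**
(`T > 0`): under hypothesis i) for the systems `dWaveZ2System (L+1) t U μ g`, for every `B > 0`, `ε' > 0`,
eventually in `L, L'`: `√2 · (|Λ_{L'}|⁻² ⟨(Δ_g+Δ_g†)²⟩_{β,0,L'})^{1/2} ≤ |Λ_L|⁻¹ ⟨Δ_g+Δ_g†⟩_{β,B,L} + ε'`.
Instance of lit-1's `Z2System.kt93_corollary_2_2_u1` with `O^{(2)} = i(Δ_g−Δ_g†)`, `C = N̂`, `ε = −2i`,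
`κ = 50`. [cite: KomaTasaki1993, Corollary 2.2 (2.18) with Remark after Theorem 6.1 (U(1): factor √2)] -/
theorem dWave_kt93_corollary_2_2_u1 (hg : 0 < pairNormConst g) {β : ℝ} (hβ : 0 < β)
    (hlim : ∀ B : ℝ, ∃ f : ℝ,
      Tendsto (fun L : ℕ => (dWaveZ2System (L + 1) t U μ g).freeEnergy β B) atTop (𝓝 f))
    {B : ℝ} (hB : 0 < B) {ε' : ℝ} (hε' : 0 < ε') :
    ∃ L₀ : ℕ, ∀ L L' : ℕ, L₀ ≤ L → L₀ ≤ L' →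
      Real.sqrt 2 * Real.sqrt ((dWaveZ2System (L' + 1) t U μ g).moment β 1) ≤
        (dWaveZ2System (L + 1) t U μ g).magnetisation β B + ε' := by
  refine KomaTasaki.Z2System.kt93_corollary_2_2_u1 (fun L => dWaveZ2System (L + 1) t U μ g)
    (fun L => I • (pairField g (L + 1) - (pairField g (L + 1))ᴴ)) (fun L => totalNumber)
    (ε := -2 * I) (κ := 50) ?_ (by norm_num) (fun L => isHermitian_I_smul_pairField_sub (L + 1) g) ?_ ?_ ?_
    ?_ ?_ hβ tendsto_card_torusSite_succ hlim B hB ε' hε'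
  · exact mul_ne_zero (by norm_num) Complex.I_ne_zero
  · intro L
    rw [dWaveZ2System_hamiltonian]
    exact hamiltonianWith_commute_totalNumber (fermionTorusGraph 2 (L + 1)) t U μ
  · intro L
    rw [dWaveZ2System_order]
    exact totalNumber_comm_I_smul_pairField_sub (L + 1) g
  · intro L
    rw [dWaveZ2System_order]
    exact totalNumber_comm_pairField_add (L + 1) g
  · intro L
    exact norm_I_smul_pairField_sub_le (L + 1) g
  · intro L
    rw [dWaveZ2System_order]
    exact norm_comm_orderTwo_orderOne_le (L + 1) g hg

/-- **THERMAL `d`-WAVE PAIR LRO FORCES THE SOURCED THERMAL PAIR AMPLITUDE, WITH THE SHARP `U(1)` FACTOR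
`√2`** (torus vocabulary, `t = 1`, `d`-wave): under hypothesis i), for every `B > 0`, `ε > 0`, eventually
in `L, L'`:
`√2 · √( ((L'+1)²)⁻² · Re⟨(Δ_d+Δ_d†)²⟩_{β, dWaveSourceTorus (L'+1) U μ 0} )
   ≤ ((L+1)²)⁻¹ · Re⟨Δ_d+Δ_d†⟩_{β, dWaveSourceTorus (L+1) U μ B} + ε` — the thermal twin of the tree's
`T = 0` `√2`-sharp `le_dWaveOrderParameter_of_pairLRO`.
[cite: KomaTasaki1993, Corollary 2.2 (2.18) with Remark after Theorem 6.1 (U(1): factor √2)] -/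
theorem dWave_thermal_pairLRO_le_sourcedPairAmplitude_sqrtTwo (U μ : ℝ) {β : ℝ} (hβ : 0 < β)
    (hlim : ∀ B : ℝ, ∃ f : ℝ,
      Tendsto (fun L : ℕ => (dWaveZ2System (L + 1) 1 U μ dWaveFormFactor).freeEnergy β B) atTop (𝓝 f))
    {B : ℝ} (hB : 0 < B) {ε : ℝ} (hε : 0 < ε) :
    ∃ L₀ : ℕ, ∀ L L' : ℕ, L₀ ≤ L → L₀ ≤ L' →
      Real.sqrt 2 * Real.sqrt (((((L' + 1 : ℕ) : ℝ) ^ 2) ^ 2)⁻¹ *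
          (gibbsState β (dWaveSourceTorus (L' + 1) U μ 0)
            ((pairField dWaveFormFactor (L' + 1) + (pairField dWaveFormFactor (L' + 1))ᴴ) ^ 2)).re) ≤
        ((((L + 1 : ℕ) : ℝ) ^ 2))⁻¹ * (gibbsState β (dWaveSourceTorus (L + 1) U μ B)
          (pairField dWaveFormFactor (L + 1) + (pairField dWaveFormFactor (L + 1))ᴴ)).re + ε := by
  obtain ⟨L₀, hL₀⟩ := dWave_kt93_corollary_2_2_u1 1 U μ dWaveFormFactor pairNormConst_dWave_pos hβ hlim hB hε
  refine ⟨L₀, fun L L' hL hL' => ?_⟩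
  have h := hL₀ L L' hL hL'
  rw [dWaveZ2System_moment_dWave, dWaveZ2System_magnetisation_dWave] at h
  convert h using 3

/-- The `√2`-sharp thermal inequality from a sourced-pressure limit in `ε–L₀` form (the statement of the
Hubbard summit's `Theorems.stub_sourcedPressureLimit`, verbatim ⇒ unconditional on the summit side).
[cite: KomaTasaki1993, Corollary 2.2 (2.18) with Remark after Theorem 6.1 (U(1): factor √2)] -/
theorem dWave_thermal_pairLRO_le_sourcedPairAmplitude_sqrtTwo_of_pressureLimit (U μ : ℝ) {β : ℝ} (hβ : 0 < β)
    (hq : ∀ h : ℝ, ∃ q : ℝ, ∀ κ : ℝ, 0 < κ → ∃ L₀ : ℕ, ∀ (L : ℕ) [NeZero L], L₀ ≤ L →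
      |Real.log (partitionFn β (dWaveSourceTorus L U μ h)).re / (β * (L : ℝ) ^ 2) - q| ≤ κ)
    {B : ℝ} (hB : 0 < B) {ε : ℝ} (hε : 0 < ε) :
    ∃ L₀ : ℕ, ∀ L L' : ℕ, L₀ ≤ L → L₀ ≤ L' →
      Real.sqrt 2 * Real.sqrt (((((L' + 1 : ℕ) : ℝ) ^ 2) ^ 2)⁻¹ *
          (gibbsState β (dWaveSourceTorus (L' + 1) U μ 0)
            ((pairField dWaveFormFactor (L' + 1) + (pairField dWaveFormFactor (L' + 1))ᴴ) ^ 2)).re) ≤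
        ((((L + 1 : ℕ) : ℝ) ^ 2))⁻¹ * (gibbsState β (dWaveSourceTorus (L + 1) U μ B)
          (pairField dWaveFormFactor (L + 1) + (pairField dWaveFormFactor (L + 1))ᴴ)).re + ε :=
  dWave_thermal_pairLRO_le_sourcedPairAmplitude_sqrtTwo U μ hβ
    (dWaveZ2System_freeEnergy_tendsto_of_pressureLimit U μ β hq) hB hε

end SqrtTwo

end Literature.MathematicalPhysics.QuantumLattice

end
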